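import Mathlib
import Summits.Ventures.PercRepro2.ExplorationTreeFresh
import Summits.Ventures.PercRepro2.Explore
import Summits.Ventures.PercRepro2.ExploreHalt

/-!
# Stopping rules are stopping explorations: the conditional expectation given the record of a
stopping rule is the expectation under the record weights (blind cell PercRepro2, typer-1 g20; a
language line)

The cell carries two formalisms of an exploration: the DECISION TREES `ExplorationTree.ETree`
(leaves = partial configurations; the stopping-exploration line A–F) and the RECORD-BASED STOPPING
RULES `Explore.StoppingRule` of `Explore.lean` (a map `record : Config E → Record E` that reads only
the edges it has explored; p1's halted exploration `ExploreHalt.haltRule` is one).  This file puts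
the second on the same measure-theoretic footing as the first:

* **`Record.toPartial`**: a record `(op, cl)` is the partial configuration `(op ∪ cl, 1 on op)`;
  its event is the record's cylinder (`toPartial_event`) and its pinned weights are the record
  weights (`weights_eq_pin`, `T.weights p = pin p T.toPartial`);
* **`expect_indicator_preimage_record`**: `E_p[1_{record⁻¹ S} · h] = Σ_{T ∈ records, T ∈ S}
  mass T · E_{p_T} h` (any commutative ring);
* **`recordSigma rule = σ(record)`**, **`recordMean p rule f ω = E_{p_{record ω}} f`**, and
  **`condExp_recordSigma`**: `μ_p[f | recordSigma rule] =ᵐ recordMean p rule f` for every weight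
  vector and every stopping rule — the conditional expectation given the record is the expectation
  under the record weights; **`expect_recordMean`** (the disintegration);
* **the frozen forms**: `E_{p_T} g = E_p (g ∘ T.toPartial.freeze)` (`expect_weights_eq_expect_freeze`)
  and `μ_p[g | recordSigma rule] =ᵐ ω ↦ E_p (g ∘ (record ω).toPartial.freeze)`
  (`condExp_recordSigma_freeze`): what the rule has not explored is fresh;
* **`condExp_recordSigma_haltRule`**: the instance for p1's halted exploration from `a₁`
  (`ExploreHalt.haltRule`, any selector).

Identities only; no sign is claimed; the crux and the residual are as they are.
-/

namespace Summit.Ventures.PercRepro2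

open MeasureTheory ProbabilityTheory MeasureBridge

namespace Explore

/-! ## A record as a partial configuration -/

section RecordPartial

variable {E : Type*} [DecidableEq E]

/-- The partial configuration of a record: explored edges `op ∪ cl`, observed states `1` on `op`
(and `0` on `cl`). -/
def Record.toPartial (T : Record E) : ExplorationTree.Partial E :=
  ⟨T.explored, fun e => decide (e ∈ T.op)⟩

/-- The explored set of the partial configuration of a record. -/
@[simp] lemma Record.toPartial_F (T : Record E) : T.toPartial.F = T.explored := rfl

/-- The event of the partial configuration of a record is the record's cylinder. -/
lemma Record.toPartial_event (T : Record E) : T.toPartial.event = T.cyl := by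
  ext ω
  simp only [ExplorationTree.Partial.mem_event, Record.toPartial, Record.explored,
    Finset.mem_union, Record.mem_cyl]
  constructor
  · intro h
    refine ⟨fun e he => ?_, fun e he => ?_⟩
    · rw [h e (Or.inl he)]
      simp [he]
    · rw [h e (Or.inr he)]
      have : e ∉ T.op := Finset.disjoint_right.1 T.disj he
      simp [this]
  · rintro ⟨h1, h2⟩ e he
    rcases he with ho | hc
    · rw [h1 e ho]
      simp [ho]
    · rw [h2 e hc]
      have : e ∉ T.op := Finset.disjoint_right.1 T.disj hc
      simp [this]

variable {R : Type*} [CommRing R]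

/-- The record weights are the pinned weights of the record's partial configuration. -/
lemma Record.weights_eq_pin (T : Record E) (p : E → R) :
    T.weights p = ExplorationTree.pin p T.toPartial := by
  funext e
  simp only [Record.weights, ExplorationTree.pin, Record.toPartial, Record.explored,
    Finset.mem_union]
  by_cases ho : e ∈ T.op
  · simp [ho]
  · by_cases hc : e ∈ T.cl
    · simp [ho, hc]
    · simp [ho, hc]

variable [Fintype E]

/-- Expectations under the record weights only see the cylinder. -/
lemma expect_weights_congr (T : Record E) (p : E → R) {f g : Config E → R}
    (h : ∀ ω ∈ T.cyl, f ω = g ω) : expect (T.weights p) f = expect (T.weights p) g := by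
  rw [T.weights_eq_pin]
  exact ExplorationTree.expect_pin_congr p T.toPartial (by rw [T.toPartial_event]; exact h)

/-- **What the record has not explored is fresh**: the expectation under the record weights of
ANY observable is the unconditional expectation of the observable with the explored edges frozen at
the record. -/
theorem expect_weights_eq_expect_freeze (T : Record E) (p : E → R) (g : Config E → R) :
    expect (T.weights p) g = expect p (g ∘ T.toPartial.freeze) := by
  rw [T.weights_eq_pin]
  exact ExplorationTree.expect_pin_eq_expect_freeze p T.toPartial g

/-- An observable of the edges not explored by the record keeps its unconditional mean under the
record weights. -/
theorem expect_weights_eq_of_dependsOn_compl (T : Record E) (p : E → R) {f : Config E → R}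
    (hf : DependsOn f ((↑T.explored : Set E)ᶜ)) : expect (T.weights p) f = expect p f := by
  rw [T.weights_eq_pin]
  exact ExplorationTree.expect_pin_eq_of_dependsOn_compl p T.toPartial hf

end RecordPartial

/-! ## The preimage sets of the record map -/

section Records

variable {E : Type*} [Fintype E] [DecidableEq E] {R : Type*} [CommRing R]

/-- On the cylinder of a record in the range of the rule, the record map is that record. -/
lemma StoppingRule.record_eq_of_mem_cyl (rule : StoppingRule E) {T : Record E}
    (hT : T ∈ rule.records) {ω : Config E} (hω : ω ∈ T.cyl) : rule.record ω = T := by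
  obtain ⟨ω₀, -, h₀⟩ := Finset.mem_image.1 hT
  rw [← h₀]
  exact (rule.record_eq_iff_mem_cyl ω₀ ω).2 (h₀ ▸ hω)

open Classical in
/-- **The mass of a preimage set of the record map**:
`E_p[1_{record⁻¹ S} · h] = Σ_{T ∈ records} mass T · (if T ∈ S then E_{p_T} h else 0)`. -/
theorem StoppingRule.expect_indicator_preimage_record (rule : StoppingRule E) (p : E → R)
    (S : Set (Record E)) (h : Config E → R) :
    expect p ((rule.record ⁻¹' S).indicator h) =
      ∑ T ∈ rule.records, T.mass p * (if T ∈ S then expect (T.weights p) h else 0) := by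
  rw [rule.expect_eq_sum_records]
  refine Finset.sum_congr rfl fun T hT => ?_
  congr 1
  by_cases hS : T ∈ S
  · rw [if_pos hS]
    exact expect_weights_congr T p fun ω hω =>
      Set.indicator_of_mem (by rw [Set.mem_preimage, rule.record_eq_of_mem_cyl hT hω]; exact hS) h
  · rw [if_neg hS]
    refine (expect_weights_congr T p (g := fun _ => 0) fun ω hω => ?_).trans (expect_const _ 0)
    exact Set.indicator_of_notMem
      (by rw [Set.mem_preimage, rule.record_eq_of_mem_cyl hT hω]; exact hS) h

end Records

/-! ## The σ-algebra of a stopping rule and the conditional expectation -/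

section CondExp

variable {E : Type*} [Fintype E] [DecidableEq E]

/-- The σ-algebra of a stopping rule: generated by its record map (`σ(record)`). -/
abbrev recordSigma (rule : StoppingRule E) : MeasurableSpace (Config E) :=
  MeasurableSpace.comap rule.record (⊤ : MeasurableSpace (Record E))

/-- The σ-algebra of a stopping rule is coarser than the product σ-algebra. -/
lemma recordSigma_le (rule : StoppingRule E) :
    recordSigma rule ≤ (inferInstance : MeasurableSpace (Config E)) := by
  rintro s ⟨T, -, rfl⟩
  exact MeasurableSet.of_discrete

/-- The expectation under the weights of the record reached: `ω ↦ E_{p_{record ω}} f`. -/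
noncomputable def recordMean (p : E → ℝ) (rule : StoppingRule E) (f : Config E → ℝ) :
    Config E → ℝ :=
  fun ω => expect ((rule.record ω).weights p) f

/-- `recordMean` factors through the record map. -/
lemma recordMean_eq_comp (p : E → ℝ) (rule : StoppingRule E) (f : Config E → ℝ) :
    recordMean p rule f = (fun T => expect (T.weights p) f) ∘ rule.record := rfl

/-- On the cylinder of a record in the range, `recordMean` is the constant `E_{p_T} f`. -/
lemma recordMean_eq_of_mem_cyl (p : E → ℝ) (rule : StoppingRule E) (f : Config E → ℝ)
    {T : Record E} (hT : T ∈ rule.records) {ω : Config E} (hω : ω ∈ T.cyl) :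
    recordMean p rule f ω = expect (T.weights p) f := by
  simp only [recordMean]
  rw [rule.record_eq_of_mem_cyl hT hω]

/-- **The conditional expectation given the record of a stopping rule is the expectation under
the record weights**: `μ_p[f | recordSigma rule] =ᵐ recordMean p rule f`, for every weight vector
and every stopping rule. -/
theorem condExp_recordSigma (p : E → ℝ) (hp : IsProbVec p) (rule : StoppingRule E)
    (f : Config E → ℝ) :
    (percMeasureOf p hp)[f | recordSigma rule] =ᵐ[percMeasureOf p hp] recordMean p rule f := by
  classical
  refine (ae_eq_condExp_of_forall_setIntegral_eq (recordSigma_le rule) Integrable.of_finite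
    (fun _ _ _ => Integrable.of_finite.integrableOn) ?_ ?_).symm
  · intro s hs _
    obtain ⟨S, -, rfl⟩ := hs
    rw [← integral_indicator MeasurableSet.of_discrete, ← integral_indicator MeasurableSet.of_discrete,
      integral_percMeasureOf, integral_percMeasureOf, rule.expect_indicator_preimage_record,
      rule.expect_indicator_preimage_record]
    refine Finset.sum_congr rfl fun T hT => ?_
    congr 1
    by_cases hS : T ∈ S
    · rw [if_pos hS, if_pos hS, expect_weights_congr T p (g := fun _ => expect (T.weights p) f)
        fun ω hω => recordMean_eq_of_mem_cyl p rule f hT hω, expect_const]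
    · rw [if_neg hS, if_neg hS]
  · rw [recordMean_eq_comp]
    exact (measurable_from_top.comp (comap_measurable (m := ⊤) rule.record)).stronglyMeasurable
      |>.aestronglyMeasurable

/-- **Disintegration over the records**: `E_p f = E_p[ω ↦ E_{p_{record ω}} f]`. -/
theorem expect_recordMean (p : E → ℝ) (hp : IsProbVec p) (rule : StoppingRule E)
    (f : Config E → ℝ) : expect p (recordMean p rule f) = expect p f := by
  rw [← integral_percMeasureOf p hp, ← integral_percMeasureOf p hp,
    ← integral_congr_ae (condExp_recordSigma p hp rule f), integral_condExp (recordSigma_le rule)]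

/-- The record mean of any observable is an unconditional mean of the frozen observable. -/
lemma recordMean_eq_expect_freeze (p : E → ℝ) (rule : StoppingRule E) (g : Config E → ℝ) :
    recordMean p rule g = fun ω => expect p (g ∘ (rule.record ω).toPartial.freeze) := by
  funext ω
  simp only [recordMean]
  exact expect_weights_eq_expect_freeze _ p g

/-- **What the rule has not explored is fresh, in `condExp` form**:
`μ_p[g | recordSigma rule] =ᵐ ω ↦ E_p (g ∘ (record ω).toPartial.freeze)`. -/
theorem condExp_recordSigma_freeze (p : E → ℝ) (hp : IsProbVec p) (rule : StoppingRule E)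
    (g : Config E → ℝ) :
    (percMeasureOf p hp)[g | recordSigma rule] =ᵐ[percMeasureOf p hp]
      fun ω => expect p (g ∘ (rule.record ω).toPartial.freeze) := by
  have h := condExp_recordSigma p hp rule g
  rwa [recordMean_eq_expect_freeze p rule g] at h

end CondExp

/-! ## Instance: p1's halted exploration from `a₁` -/

section Halt

variable {V : Type*} {E : Type*} [DecidableEq V] [DecidableEq E] [Fintype V] [Fintype E]
  {ends : E → Sym2 V}

/-- **p1's halted exploration from `a₁` (any selector) is a stopping exploration at the measure
level**: the conditional expectation given its record is the expectation under the record
weights. -/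
theorem condExp_recordSigma_haltRule (p : E → ℝ) (hp : IsProbVec p) (sel : Selector ends)
    (a₁ a₃ : V) (f : Config E → ℝ) :
    (percMeasureOf p hp)[f | recordSigma (haltRule sel a₁ a₃)] =ᵐ[percMeasureOf p hp]
      recordMean p (haltRule sel a₁ a₃) f :=
  condExp_recordSigma p hp (haltRule sel a₁ a₃) f

end Halt

end Explore

end Summit.Ventures.PercRepro2
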